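import Mathlib
import Literature.Analysis.FluidPDE.Tao2016AveragedNS.ShiftSetCascadeFlows
import Summits.NavierStokesRegularity.NavierStokesRegularity.Theorems.TaoLadderRungTwoFlatCertificateGlueLohnerDenseOn
import HarnessLib

/-!
# Certificate glue on a shift set `𝕊`, XIX-g: BOX REGION — the per-component Lohner step with dense output (XIX-e) whose Lipschitz /
  input-defect region is an arbitrary BOX around the PER-COMPONENT PICARD TUBE `|q_c − x_c| ≤ ρ + u·b_c·R_h²` (row constants
  `b_c` of the bilinear field), instead of the origin-centred `R`-ball (helper for items stmt-NavierStokesRegularity-22987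
  `FlatGapCertificatesV2` (crux K_A♭ of route TaoLadderRungTwoFlat) and stmt-24295 K_A₂(64); cell harvest/h2-tao-ladder, p1 g15;
  theory-1 R9 screen NUM-T41m, bus l.534: «the failure of XIX-d on the window runs is the R-BALL REGION»)

On the window runs (edge inputs present) the input defect `δ` and the Lipschitz constant `K` must be taken on a region containing the
run; glues XIX-c, XIX-d, XIX-e take the weighted ball `|y| ≤ R·ω`, which contains states far from the trajectory (carrier range ×4e9 on hop 3,
theory-1 l.534) and makes `δ` useless. The exact flow of the step satisfies, per coordinate, the first-order PICARD bound
`|ψ_c(u) − ψ_c(0)| ≤ u · b_c · R_h²` (`|Q(y,y)_c| ≤ b_c‖y‖²_∞` with the row constant `b_c`, `‖ψ(s)‖_∞ ≤ R_h` by the majorant), so the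
tube `PicardTube` (centre box `|q_c − x_c| ≤ ρC + E₀ + u b_c R_h²`) is valid, and glue XIV-d (`stepCert_of_flowTube_local`) accepts ANY
box `G ⊇ (TubeL ∧ PicardTube) ⊕ A'·ω` with `PFieldLipOn G K` (glue XV-c `pfieldLipOn_of_table`) and `PInputDefectOn G δ`
(`pinputDefectOn_of_table`): `stepCert_of_plohner_box`.

HONEST FRAMING: Tao-type MODEL lattices (Tao 2016 §4/§6 vocabulary, shift-set parametrised); every clause is a HYPOTHESIS — nothing is
computed or certified here, no stub is closed, nothing about the Navier–Stokes equations.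
-/

noncomputable section

-- the sub-problem namespace repeats the summit name by design (D-0017)
set_option linter.dupNamespace false

namespace Summit.NavierStokesRegularity.NavierStokesRegularity.Theorems

open Set Filter Topology Literature.Analysis.FluidPDE Literature.Analysis.FluidPDE.TaoCascade
open Summit.NavierStokesRegularity.NavierStokesRegularity.Theorems.TaylorModelReadout

namespace CertificateGlueOn

variable {m : ℕ} {Kb Ka : ℤ} {ω : Fin m → ℤ → ℝ}
  {𝕊 : Finset (ℤ × ℤ × ℤ)} {ε₀ : ℝ} {α : Fin m → Fin m → Fin m → ℤ × ℤ × ℤ → ℝ} {Eb Et : ℝ}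

/-- **First-order Picard bound for a solution of a bilinear ODE with a sup-norm a priori bound**: if `ψ' = Q(ψ,ψ)` on `[0,h]`,
`|ψ(s)|_d ≤ Rh` for all `d`, and row `c` of `Q` satisfies `|Q(y,y)_c| ≤ brow·N²` whenever `|y| ≤ N`, then
`|ψ_c(u) − ψ_c(0)| ≤ u·brow·Rh²` for `u ∈ [0,h]`. [folklore] -/
theorem picard_row_bound {n : ℕ} {Q : (Fin n → ℝ) → (Fin n → ℝ) → Fin n → ℝ} {h Rh brow : ℝ} {c : Fin n}
    (hRh : 0 ≤ Rh) (hQc : ∀ (y : Fin n → ℝ) (N : ℝ), 0 ≤ N → (∀ d, |y d| ≤ N) → |Q y y c| ≤ brow * N ^ 2)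
    {ψ : ℝ → Fin n → ℝ} (hψd : ∀ s ∈ Icc 0 h, HasDerivWithinAt ψ (Q (ψ s) (ψ s)) (Icc 0 h) s)
    (hψb : ∀ s ∈ Icc 0 h, ∀ d, |ψ s d| ≤ Rh) {u : ℝ} (hu : u ∈ Icc 0 h) :
    |ψ u c - ψ 0 c| ≤ u * (brow * Rh ^ 2) := by
  -- the component function and its derivative bound
  have hder : ∀ s ∈ Icc (0 : ℝ) h, HasDerivWithinAt (fun s => ψ s c) (Q (ψ s) (ψ s) c) (Icc 0 h) s := fun s hs =>
    (hasDerivWithinAt_pi.1 (hψd s hs)) c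
  have hbound : ∀ s ∈ Icc (0 : ℝ) h, ‖Q (ψ s) (ψ s) c‖ ≤ brow * Rh ^ 2 := fun s hs => by
    rw [Real.norm_eq_abs]; exact hQc (ψ s) Rh hRh (hψb s hs)
  have hmvt := Convex.norm_image_sub_le_of_norm_hasDerivWithin_le hder hbound (convex_Icc 0 h)
    (show (0 : ℝ) ∈ Icc 0 h from ⟨le_rfl, hu.1.trans hu.2⟩) hu
  rw [Real.norm_eq_abs, Real.norm_eq_abs, sub_zero, abs_of_nonneg hu.1] at hmvt
  linarith [hmvt]

/-- **THE PER-COMPONENT PICARD TUBE** of a Lohner step at time `u`: `|pxcoord q c − x c| ≤ ρC + E₀ + u · brow c · R_h²`. [folklore] -/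
def PicardTube (Kb Ka : ℤ) (ω : Fin m → ℤ → ℝ) (x brow : Fin (m * winLen Kb Ka) → ℝ) (ρC E₀ Rh : ℝ) (u : ℝ)
    (q : Fin m → ℤ → ℝ) : Prop :=
  ∀ c, |pxcoord Kb Ka ω q c - x c| ≤ ρC + E₀ + u * (brow c * Rh ^ 2)

/-- **`StepCert` FROM A PER-COMPONENT LOHNER STEP WITH DENSE OUTPUT AND A BOX REGION AROUND THE PICARD TUBE** (glue XIX-e with the
`R`-ball replaced by any box `G ⊇ (TubeL ∧ PicardTube) ⊕ A'·ω`, `K` and `δ` on `G`; see the module docstring).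
[cite: Zgliczynski2002C1Lohner, §3–4 (Lohner-type parallelepiped frames and the C¹/variational enclosure); cell certificate format, Lohner step, box region] -/
theorem stepCert_of_plohner_box (hKb : 0 ≤ Kb) (hKa : 1 ≤ Ka) (hε : 0 < 1 + ε₀) (hω : ∀ i k, 0 < ω i k)
    {M : ℤ → ℝ} {t : ℕ → ℝ} {Node Hull : ℕ → (Fin m → ℤ → ℝ) → Prop} {j p : ℕ}
    {b mC ρC E₀ E₁ dP NVh κI K δ A A' : ℝ} {x x' brow : Fin (m * winLen Kb Ka) → ℝ}
    {C Cn Cin : Matrix (Fin (m * winLen Kb Ka)) (Fin (m * winLen Kb Ka)) ℝ} {r r' : Fin (m * winLen Kb Ka) → ℝ}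
    {glo ghi : Fin m → ℤ → ℝ}
    (hb : 0 ≤ b) (hmC : 0 ≤ mC) (hρC : 0 ≤ ρC) (hE₀ : 0 ≤ E₀) (hK : 0 ≤ K) (hδ : 0 ≤ δ) (hAA' : A < A')
    (hh : 0 ≤ t (j + 1) - t j) (hguard : b * (mC + (ρC + E₀)) * (t (j + 1) - t j) < 1)
    (hB : ∀ i k, -Kb ≤ k → k ≤ Ka →
      ∑ i₁ : Fin m, ∑ i₂ : Fin m, ∑ μ ∈ 𝕊,
        |α i₁ i₂ i μ| * (1 + ε₀) ^ ((5 : ℝ) * (k - μ.2.2) / 2) *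
          (pwExt Kb Ka ω i₁ (k - μ.2.2 + μ.1) * pwExt Kb Ka ω i₂ (k - μ.2.2 + μ.2.1)) ≤ b * ω i k)
    (hBrow : ∀ (y : Fin (m * winLen Kb Ka) → ℝ) (N : ℝ), 0 ≤ N → (∀ d, |y d| ≤ N) →
      ∀ c, |PQcN 𝕊 ε₀ α Kb Ka ω y y c| ≤ brow c * N ^ 2)
    (hx : ∀ c, |x c| ≤ mC)
    (hC : ∀ ξ : Fin (m * winLen Kb Ka) → ℝ, (∀ c, |ξ c| ≤ r c) → ∀ c, |C.mulVec ξ c| ≤ ρC)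
    (hclauses : LandingClausesAt (PQcN 𝕊 ε₀ α Kb Ka ω) p b mC ρC E₀ x C r (t (j + 1) - t j)
      x' Cn Cin r' dP NVh κI E₁)
    -- the box region: contains every state within `A'·ω` of a state in the Picard tube (at any `u ≤ h`)
    (hG : ∀ u ∈ Icc 0 (t (j + 1) - t j), ∀ q y : Fin m → ℤ → ℝ,
      PicardTube Kb Ka ω x brow ρC E₀ ((mC + (ρC + E₀)) / (1 - b * (mC + (ρC + E₀)) * (t (j + 1) - t j))) u q →
      (∀ i k, -Kb ≤ k → k ≤ Ka → |y i k - q i k| ≤ A' * ω i k) → InBoxOn Kb Ka glo ghi y)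
    (hlip : PFieldLipOn 𝕊 ε₀ α Kb Ka ω glo ghi K) (hdef : PInputDefectOn 𝕊 ε₀ α Kb Ka Eb Et ω glo ghi δ)
    (hA : gronwallBound 0 K δ (t (j + 1) - t j) ≤ A)
    (hN : ∀ y, Node j y → PInPara Kb Ka ω x C r E₀ y)
    (hH : ∀ u ∈ Icc 0 (t (j + 1) - t j), ∀ y q : Fin m → ℤ → ℝ,
      TubeL 𝕊 ε₀ α Kb Ka ω p b mC ρC E₀ ((mC + (ρC + E₀)) / (1 - b * (mC + (ρC + E₀)) * (t (j + 1) - t j)))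
        x C r u q → PicardTube Kb Ka ω x brow ρC E₀ ((mC + (ρC + E₀)) / (1 - b * (mC + (ρC + E₀)) * (t (j + 1) - t j))) u q →
      (∀ i k, -Kb ≤ k → k ≤ Ka → |y i k - q i k| ≤ A * ω i k) → Hull j y)
    (hN' : ∀ y, PInPara Kb Ka ω x' Cn r' (E₁ + A) y → Node (j + 1) y) :
    StepCert 𝕊 ε₀ α Kb Ka Eb Et M t Node Hull j := by
  have hKK : 0 ≤ Ka + Kb + 1 := by omega
  set h := t (j + 1) - t j with hhdef
  set ρ := ρC + E₀ with hρdef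
  have hρ0 : 0 ≤ ρ := by positivity
  set Rh := (mC + ρ) / (1 - b * (mC + ρ) * h) with hRh
  have hden : 0 < 1 - b * (mC + ρ) * h := by linarith
  have hRh0 : 0 ≤ Rh := div_nonneg (by positivity) hden.le
  set Q := PQcN 𝕊 ε₀ α Kb Ka ω with hQ
  have hBQ := pqcN_bound_of_table (𝕊 := 𝕊) (ε₀ := ε₀) (α := α) hε hω hKK hB
  have hQl : ∀ u, IsLinearMap ℝ (Q u) := isLinearMap_PQcN_right
  have hQr : ∀ v, IsLinearMap ℝ (fun u => Q u v) := isLinearMap_PQcN_left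
  have hmaj : ∀ u ∈ Icc 0 h, (mC + ρ) / (1 - b * (mC + ρ) * u) ≤ Rh := by
    intro u hu
    exact div_le_div_of_nonneg_left (by positivity) hden (by nlinarith [mul_nonneg hb (add_nonneg hmC hρ0), hu.2])
  -- the dense flow of glue XIX-e, refined by the Picard tube: rebuild the flow with both properties
  have hflow : ∀ z : Fin m → ℤ → ℝ, PInPara Kb Ka ω x C r E₀ z → ∃ ψ : Fin m → ℤ → ℝ → ℝ,
      (∀ i k, -Kb ≤ k → k ≤ Ka → ψ i k 0 = z i k) ∧
      (∀ i k, -Kb ≤ k → k ≤ Ka → ∀ u ∈ Icc 0 h,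
        HasDerivWithinAt (ψ i k) (truncField 𝕊 ε₀ α Kb Ka (slice ψ u) i k) (Icc 0 h) u) ∧
      (∀ u ∈ Icc 0 h, (fun u q => TubeL 𝕊 ε₀ α Kb Ka ω p b mC ρC E₀ Rh x C r u q ∧ PicardTube Kb Ka ω x brow ρC E₀ Rh u q)
        u (slice ψ u)) ∧
      PInPara Kb Ka ω x' Cn r' E₁ (slice ψ h) := by
    intro z hz
    -- coordinates: existence + majorant + landing at every `u` (as in glue XIX-e), keeping the coordinate solution at hand
    obtain ⟨ξ, e, hξ, he, hze⟩ := hz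
    set v := C.mulVec ξ + e with hvdef
    have hv : ∀ c, |v c| ≤ ρ := fun c => (abs_add_le _ _).trans (add_le_add (hC ξ hξ c) (he c))
    obtain ⟨ψ, hψ0, hψd, hψb⟩ := lohner_exists hQl hQr hb hBQ hh hmC hρ0 hx hguard v hv
    have hψb' : ∀ s ∈ Icc 0 h, ∀ d, |ψ s d| ≤ Rh := fun s hs d => (hψb s hs d).trans (hmaj s hs)
    -- the cascade family of glue XIX-e from the SAME data has the same coordinates; we use `plohner_flow_dense` for the
    -- tube/landing part and the Picard bound for the box part, on the family built from `ψ`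
    have hstart : (ψ 0) ∘ finProdFinEquiv = pwcoord Kb Ka ω z := by
      rw [hψ0, ← hze]; funext c; simp [pxcoord]
    have hsl : ∀ u, slice (fun i k u => pwstate Kb Ka ω ((ψ u) ∘ finProdFinEquiv) i k) u =
        pwstate Kb Ka ω ((ψ u) ∘ finProdFinEquiv) := fun u => by funext i' k'; rfl
    have hxc : ∀ u, pxcoord Kb Ka ω (pwstate Kb Ka ω ((ψ u) ∘ finProdFinEquiv)) = ψ u := by
      intro u; funext d
      simp only [pxcoord, pwcoord_pwstate hω hKK, Function.comp_apply, Equiv.apply_symm_apply]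
    -- landing at any `u ≤ h`
    have hlandAt : ∀ u ∈ Icc 0 h, ∀ (x'' : Fin (m * winLen Kb Ka) → ℝ)
        (Cn'' Cin'' : Matrix (Fin (m * winLen Kb Ka)) (Fin (m * winLen Kb Ka)) ℝ) (r'' : Fin (m * winLen Kb Ka) → ℝ)
        (dP'' NVh'' κI'' E₁'' : ℝ), LandingClausesAt Q p b mC ρC E₀ x C r u x'' Cn'' Cin'' r'' dP'' NVh'' κI'' E₁'' →
        PInPara Kb Ka ω x'' Cn'' r'' E₁'' (pwstate Kb Ka ω ((ψ u) ∘ finProdFinEquiv)) := by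
      intro u hu x'' Cn'' Cin'' r'' dP'' NVh'' κI'' E₁'' hcl
      obtain ⟨h1, h2, h3, h4, h5⟩ := hcl
      have hgu : b * (mC + (ρC + E₀)) * u < 1 :=
        lt_of_le_of_lt (by nlinarith [mul_nonneg hb (add_nonneg hmC hρ0), hu.2]) hguard
      exact pinPara_of_coords hω hKK (lohner_land_approx hQl hQr hb hBQ hu.1 hmC hρC hE₀ hx hgu hC h1 h2 h3 h4 h5 ξ e hξ he ψ hψ0
        (fun s hs => (hψd s ⟨hs.1, hs.2.trans hu.2⟩).mono (Icc_subset_Icc_right hu.2)))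
    refine ⟨fun i k u => pwstate Kb Ka ω ((ψ u) ∘ finProdFinEquiv) i k, fun i k hk1 hk2 => ?_,
      fun i k hk1 hk2 u hu => ?_, fun u hu => ⟨⟨fun i k hk1 hk2 => ?_, ?_⟩, fun c => ?_⟩, ?_⟩
    · show pwstate Kb Ka ω ((ψ 0) ∘ finProdFinEquiv) i k = z i k
      rw [hstart, pwstate_pwcoord hω z i hk1 hk2]
    · -- the window equation (as in glue XIX-c)
      have hlt : (k + Kb).toNat < winLen Kb Ka := by
        unfold winLen; rw [Int.toNat_lt_toNat (by omega)]; omega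
      set c : Fin (winLen Kb Ka) := ⟨(k + Kb).toNat, hlt⟩ with hc
      have hsh : shellAt Kb c = k := by
        simp only [shellAt, hc]; rw [Int.toNat_of_nonneg (by omega)]; ring
      have hfun : (fun u => pwstate Kb Ka ω ((ψ u) ∘ finProdFinEquiv) i k) =
          fun u => ω i k * ψ u (finProdFinEquiv (i, c)) := by
        funext u
        have := pwstate_on (ω := ω) ((ψ u) ∘ finProdFinEquiv) hKK i c
        rw [hsh] at this
        simpa using this
      dsimp only
      rw [hfun]
      have hd := (hasDerivWithinAt_pi.1 (hψd u hu) (finProdFinEquiv (i, c))).const_mul (ω i k)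
      refine hd.congr_deriv ?_
      rw [hsl u, truncField_eq_biFieldOn]
      have hQapp : Q (ψ u) (ψ u) (finProdFinEquiv (i, c)) =
          biFieldOn 𝕊 ε₀ α Kb Ka (pwstate Kb Ka ω ((ψ u) ∘ finProdFinEquiv))
            (pwstate Kb Ka ω ((ψ u) ∘ finProdFinEquiv)) i k / ω i k := by
        simp only [hQ, PQcN, PQc, Equiv.symm_apply_apply, pwcoord]
        rw [hsh]
      rw [hQapp]
      field_simp [(hω i k).ne']
    · -- majorant ball
      have hlt : (k + Kb).toNat < winLen Kb Ka := by
        unfold winLen; rw [Int.toNat_lt_toNat (by omega)]; omega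
      set c : Fin (winLen Kb Ka) := ⟨(k + Kb).toNat, hlt⟩ with hc
      have hsh : shellAt Kb c = k := by
        simp only [shellAt, hc]; rw [Int.toNat_of_nonneg (by omega)]; ring
      have hvb := hψb' u hu (finProdFinEquiv (i, c))
      have := pwstate_on (ω := ω) ((ψ u) ∘ finProdFinEquiv) hKK i c
      rw [hsh] at this
      simp only [slice_apply]
      rw [this, abs_mul, abs_of_pos (hω i k), mul_comm]
      exact mul_le_mul_of_nonneg_right (by simpa using hvb) (hω i k).le
    · -- parallelepipeds certified at `u`
      intro x'' Cn'' Cin'' r'' dP'' NVh'' κI'' E₁'' hcl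
      rw [hsl u]
      exact hlandAt u hu x'' Cn'' Cin'' r'' dP'' NVh'' κI'' E₁'' hcl
    · -- the Picard tube
      rw [hsl u, hxc u]
      have hpic := picard_row_bound (c := c) hRh0 (fun y N hN hy => hBrow y N hN hy c) hψd hψb' hu
      rw [hψ0] at hpic
      have hvc := hv c
      have : |ψ u c - x c| ≤ |ψ u c - (x + v) c| + |v c| := by
        have := abs_sub_le (ψ u c) ((x + v) c) (x c)
        simpa [Pi.add_apply] using this
      linarith
    · rw [hsl h]
      exact hlandAt h ⟨hh, le_rfl⟩ x' Cn Cin r' dP NVh κI E₁ hclauses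
  exact stepCert_of_flowTube_local (Start := PInPara Kb Ka ω x C r E₀) (Land := PInPara Kb Ka ω x' Cn r' E₁)
    (Tube := fun u q => TubeL 𝕊 ε₀ α Kb Ka ω p b mC ρC E₀ Rh x C r u q ∧ PicardTube Kb Ka ω x brow ρC E₀ Rh u q)
    hKb hKa hω hK hδ hAA' hN (fun u hu q y hq hnear => hG u hu q y hq.2 hnear) hlip hdef hflow hA
    (fun u hu y q hq hnear => hH u hu y q hq.1 hq.2 hnear) (fun y q hq hnear => hN' y (pinPara_of_near hω hKK hq hnear))

end CertificateGlueOn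

end Summit.NavierStokesRegularity.NavierStokesRegularity.Theorems

end
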